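import Summits.CriticalPhenomena.PercolationContinuityZ3.Theorems.SahiMasterFamilyFUnionClass
import Mathlib.Tactic.Linarith
import Mathlib.Tactic.Ring
import HarnessLib

/-!
# The `F`-inequality: absorbing bare points of the third event into the first two

Support file (cell `prim-bnk`, seat bnk-2 gen 19; `--supports stmt-CriticalPhenomena-4575`; memo
`run/shared/lean/prim/prim-l12/FROM-prim-bnk-2-g19-F-UNION-CLASS.md` §3).  No definition, no `sorry`, standard axioms.

`F(A,B;G) = (1 + μG)μ(A∩B∩G) − μG·μ(A∩B) − μ(A∩G)μ(B∩G)` is affine in `1_A`, and a point `m ∉ B∩G` carries a NONPOSITIVE charge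
(`−μG·μ(m)` on `B∖G`, `−μ(B∩G)·μ(m)` on `G∖B`, `0` elsewhere).  Hence (`F_anti_left`): **enlarging `A` by points outside `B∩G` can only
DECREASE `F`**; symmetrically for `B` (`F_anti_right`).  Combined with the union-class theorem `F_nonneg_of_third_subset_union`
(gen 19, `G ⊆ A∪B ⟹ F ≥ 0`) this gives the ABSORPTION CRITERION `F_nonneg_of_absorbable`: **if there are increasing `A' ⊇ A`, `B' ⊇ B`
with `(A'∖A) ∩ B ∩ G = ∅`, `(B'∖B) ∩ A' ∩ G = ∅` and `G ⊆ A' ∪ B'`, then `F(A,B;G) ≥ 0`** — every "bare" point of `G` (a point of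
`G ∖ (A∪B)`) whose upper set meets `B∩G` only inside `A` can be absorbed into `A` for free, and once no bare point is left the union-class
theorem applies.  (In the seat's census this criterion together with the section moves proves every triple on `{0,1}^5`; memo §3.)
HONEST FRAMING: a reduction; `F ≥ 0` in general remains OPEN. [this work]
-/

noncomputable section

open scoped Classical

namespace Summit.CriticalPhenomena.PercolationContinuityZ3.Theorems

namespace SahiFInduction

open Finset Function
open Literature.Combinatorics.Sahi2008
open Literature.Probability.Percolation.DecisionTree (ind ind_of_mem ind_of_not_mem ind_nonneg)
open Literature.Probability.Percolation.BHK2006 (weight_nonneg)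

variable {κ : Type} [Fintype κ]

local notation3 (prettyPrint := false) "μ⟦" p ", " X "⟧" => ex (bernoulliWeight p) (ind X)

/-- Monotonicity of `μ_p` under inclusion. [folklore] -/
private theorem mu_mono (p : κ → unitInterval) {X Y : Set (Set κ)} (h : X ⊆ Y) : μ⟦p, X⟧ ≤ μ⟦p, Y⟧ := by
  refine ex_mono (fun ω => weight_nonneg (fun i => (p i).2.1) (fun i => (p i).2.2) ω) (fun ω => ?_)
  by_cases hx : ω ∈ X
  · rw [ind_of_mem hx, ind_of_mem (h hx)]
  · rw [ind_of_not_mem hx]; exact ind_nonneg Y ω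

/-- **`F` is antitone in `A` off `B ∩ G`.**  If `A ⊆ A'` and every point of `A' ∩ B ∩ G` already lies in `A`, then
`F(A',B;G) ≤ F(A,B;G)`: indeed `A'∩B∩G = A∩B∩G`, so `F(A',B;G) − F(A,B;G) = −μG·[μ(A'∩B) − μ(A∩B)] − [μ(A'∩G) − μ(A∩G)]·μ(B∩G) ≤ 0`.
(Any events; no monotonicity needed.) [this work] -/
theorem F_anti_left (p : κ → unitInterval) {A A' B G : Set (Set κ)} (hsub : A ⊆ A')
    (hoff : ∀ ω, ω ∈ A' → ω ∈ B → ω ∈ G → ω ∈ A) :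
    (1 + μ⟦p, G⟧) * μ⟦p, A' ∩ B ∩ G⟧ - μ⟦p, G⟧ * μ⟦p, A' ∩ B⟧ - μ⟦p, A' ∩ G⟧ * μ⟦p, B ∩ G⟧
      ≤ (1 + μ⟦p, G⟧) * μ⟦p, A ∩ B ∩ G⟧ - μ⟦p, G⟧ * μ⟦p, A ∩ B⟧ - μ⟦p, A ∩ G⟧ * μ⟦p, B ∩ G⟧ := by
  have heq : A' ∩ B ∩ G = A ∩ B ∩ G := by
    ext ω
    constructor
    · rintro ⟨⟨hA', hB⟩, hG⟩; exact ⟨⟨hoff ω hA' hB hG, hB⟩, hG⟩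
    · rintro ⟨⟨hA, hB⟩, hG⟩; exact ⟨⟨hsub hA, hB⟩, hG⟩
  rw [heq]
  have m1 : μ⟦p, A ∩ B⟧ ≤ μ⟦p, A' ∩ B⟧ := mu_mono p (Set.inter_subset_inter_left _ hsub)
  have m2 : μ⟦p, A ∩ G⟧ ≤ μ⟦p, A' ∩ G⟧ := mu_mono p (Set.inter_subset_inter_left _ hsub)
  have g0 : 0 ≤ μ⟦p, G⟧ := ex_ind_nonneg' p _
  have bg0 : 0 ≤ μ⟦p, B ∩ G⟧ := ex_ind_nonneg' p _
  nlinarith [mul_le_mul_of_nonneg_left m1 g0, mul_le_mul_of_nonneg_right m2 bg0]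

/-- **`F` is antitone in `B` off `A ∩ G`** (symmetric to `F_anti_left`). [this work] -/
theorem F_anti_right (p : κ → unitInterval) {A B B' G : Set (Set κ)} (hsub : B ⊆ B')
    (hoff : ∀ ω, ω ∈ B' → ω ∈ A → ω ∈ G → ω ∈ B) :
    (1 + μ⟦p, G⟧) * μ⟦p, A ∩ B' ∩ G⟧ - μ⟦p, G⟧ * μ⟦p, A ∩ B'⟧ - μ⟦p, A ∩ G⟧ * μ⟦p, B' ∩ G⟧
      ≤ (1 + μ⟦p, G⟧) * μ⟦p, A ∩ B ∩ G⟧ - μ⟦p, G⟧ * μ⟦p, A ∩ B⟧ - μ⟦p, A ∩ G⟧ * μ⟦p, B ∩ G⟧ := by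
  have h := F_anti_left p (A := B) (A' := B') (B := A) (G := G) hsub hoff
  simpa only [Set.inter_comm B' A, Set.inter_comm B A, mul_comm (μ⟦p, A ∩ G⟧)] using h

/-- **ABSORPTION CRITERION.**  For increasing `A, B, G`: if there are increasing `A' ⊇ A` and `B' ⊇ B` with `A' ∩ B ∩ G ⊆ A`
(the new points of `A'` avoid `B ∩ G`), `B' ∩ A' ∩ G ⊆ B` (the new points of `B'` avoid `A' ∩ G`) and `G ⊆ A' ∪ B'` (no bare point
left), then `F(A,B;G) ≥ 0` — because `F(A,B;G) ≥ F(A',B;G) ≥ F(A',B';G) ≥ 0`, the last step by the union-class theorem. [this work] -/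
theorem F_nonneg_of_absorbable (p : κ → unitInterval) {A B G A' B' : Set (Set κ)}
    (hA' : IsUpperSet A') (hB' : IsUpperSet B') (hG : IsUpperSet G)
    (hA : A ⊆ A') (hB : B ⊆ B')
    (hoffA : ∀ ω, ω ∈ A' → ω ∈ B → ω ∈ G → ω ∈ A)
    (hoffB : ∀ ω, ω ∈ B' → ω ∈ A' → ω ∈ G → ω ∈ B)
    (hcover : G ⊆ A' ∪ B') :
    0 ≤ (1 + μ⟦p, G⟧) * μ⟦p, A ∩ B ∩ G⟧ - μ⟦p, G⟧ * μ⟦p, A ∩ B⟧ - μ⟦p, A ∩ G⟧ * μ⟦p, B ∩ G⟧ := by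
  have h1 := F_anti_left p (B := B) (G := G) hA hoffA
  have h2 := F_anti_right p (A := A') (G := G) hB hoffB
  have h3 := F_nonneg_of_third_subset_union p A' B' G hA' hB' hG hcover
  linarith

/-- **Special case: all bare points go to `A`.**  For increasing `A, B, G` and an increasing `A' ⊇ A` with `A' ∩ B ∩ G ⊆ A` and
`G ⊆ A' ∪ B`:  `F(A,B;G) ≥ 0`. [this work] -/
theorem F_nonneg_of_absorbable_left (p : κ → unitInterval) {A B G A' : Set (Set κ)}
    (hA' : IsUpperSet A') (hB : IsUpperSet B) (hG : IsUpperSet G) (hA : A ⊆ A')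
    (hoffA : ∀ ω, ω ∈ A' → ω ∈ B → ω ∈ G → ω ∈ A) (hcover : G ⊆ A' ∪ B) :
    0 ≤ (1 + μ⟦p, G⟧) * μ⟦p, A ∩ B ∩ G⟧ - μ⟦p, G⟧ * μ⟦p, A ∩ B⟧ - μ⟦p, A ∩ G⟧ * μ⟦p, B ∩ G⟧ :=
  F_nonneg_of_absorbable p hA' hB hG hA le_rfl hoffA (fun _ hB _ _ => hB) hcover

end SahiFInduction

end Summit.CriticalPhenomena.PercolationContinuityZ3.Theorems
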